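import Summits.BirchSwinnertonDyer.BirchSwinnertonDyer.Theorems.DefiniteThetaDerivedHeightCapBD05Descent
import Summits.BirchSwinnertonDyer.BirchSwinnertonDyer.Theorems.TangentConeSelmerRankSmallImageReduction
import HarnessLib

/-!
# Route DefiniteTheta with the crux `DerivedHeightCap` DISCHARGED modulo Bertolini–Darmon 2005, Cor. 3:
# the sub-problem statement from `DefiniteExactOrder′` (one extra clause in the datum) and the five shared cruxes

Route-independent `Theorems` file (cell `b2b-bsdres`, seat `b2b-bsdres-x10b`, gen 47; `--supports` stmt-BirchSwinnertonDyer-18438).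
HONEST FRAMING: prove what is provable now; no claim beyond stated classes. NO summit statement is proved: the theorem below
has SIX open hypotheses (five of them cruxes of the route, filed as open problems) and ONE cited named fact; BSD is not proved
by any of this. What IS proved, sorry-free: the route's certified glue (`Theses.DefiniteTheta.closes`, verbatim bookkeeping)
goes through with the pair (`DefiniteExactOrder`, `DerivedHeightCap`) — cruxes #2 and #3 — replaced by the SINGLE hypothesis
`DefiniteExactOrder′` := `DefiniteExactOrder` whose admissible datum carries ONE extra clause, Bertolini–Darmon's
Assumption 6 (3) `p ∤ minModularDegree V N_V`, once BD05 Cor. 3 (the Literature fact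
`BertoliniDarmon2005.cor3_thetaSq_mem_augIdeal_pow`, p759831) is granted: at the datum, Cor. 3 and the landed square root along
the tower give `rank V(ℚ) ≤ ord_J θ^{ac} ≤ r_an(V)` (`DerivedHeightCapBD05.mordellWeilRank_le_acOrderOfVanishing`), and
`SelmerRankLB` with `SelmerRankShaPFinite` (both already hypotheses of `closes`) give `r_an ≤ corank_p = rank`, so
`corank_p = r_an` in sector (a) exactly as before. In other words: modulo print, crux #3 costs the route nothing beyond the
clause `p ∤ deg(X₀(N) → E)` in crux #2's existential datum (harmless there: all but finitely many `p` per curve qualify).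

## References

* [BertoliniDarmon2005] Ann. of Math. 162 (2005), Cor. 3 (p. 3), Assumption 6 (p. 4).
* [GreenbergLNM1716] LNM 1716 (1999), §1 (corank identity).
* [SilvermanAEC2009] AEC III.3.1(b), VII.1.3(b), C.16 (isomorphism invariance, as in `closes`).
-/

noncomputable section

-- D-0017: single-problem summit, the namespace repeats the problem name by design.
set_option linter.dupNamespace false

namespace Summit.BirchSwinnertonDyer.BirchSwinnertonDyer.Theorems.DerivedHeightCapBD05

open Literature Literature.NumberTheory.EllipticCurves Literature.NumberTheory.EllipticCurves.BertoliniDarmon2005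
open Summit.BirchSwinnertonDyer.BirchSwinnertonDyer.Theses.DefiniteTheta

/-- The extra clause of `DefiniteExactOrder′` excludes only FINITELY many primes per curve: the primes dividing the (positive)
minimal modular degree. (BD05, Remark 1 after Assumption 6: "these assumptions are satisfied by all but finitely many primes once
`E` is fixed".) [cite: BertoliniDarmon2005, Assumption 6 and Remark 1 (p. 4)] -/
theorem finite_setOf_prime_dvd_minModularDegree (V : WeierstrassCurve ℚ) (N : ℕ) [NeZero N]
    (h : 0 < ModularForms.minModularDegree V N) :
    {p : ℕ | p.Prime ∧ p ∣ ModularForms.minModularDegree V N}.Finite :=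
  (Set.finite_le_nat (ModularForms.minModularDegree V N)).subset fun _ hp => Nat.le_of_dvd h hp.2

section Datum

variable {V : WeierstrassCurve ℚ} [V.IsElliptic] [V.IsGloballyMinimal] {p : ℕ} [Fact p.Prime] {Nplus Nminus : ℕ}
  {K : Type} [Field K] [NumberField K] {S : NumberTheory.Automorphic.Brandt.XiSetup Nplus Nminus}
  [Fintype (NumberTheory.Automorphic.Brandt.ClassSet S.O)] (T : GrossPointTower K S p)
  {φ : NumberTheory.Automorphic.Brandt.ClassSet S.O → ℤ}

/-- **`rank E^K(ℚ) ≤ ord_J θ^{ac}`** for the twist of `V` by `K` at every admissible datum with `p ∤ minModularDegree V N_V`,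
modulo BD05 Cor. 3 (the `r⁻` half of `max(r⁺, r⁻) ≤ ord_J θ^{ac}`, `max_rank_le_acOrderOfVanishing`).
[cite: BertoliniDarmon2005, Cor. 3 (p. 3)] -/
theorem twist_mordellWeilRank_le_acOrderOfVanishing
    (hC3 : cor3_thetaSq_mem_augIdeal_pow K S p V)
    (h : (7 ≤ p ∧ V.HasGoodReductionAtPrime p ∧ ¬ (p : ℤ) ∣ V.frobeniusTrace p ∧ ¬ (p : ℤ) ∣ (V.frobeniusTrace p) ^ 2 - 1 ∧ V.HasSurjectiveModNGaloisRep p ∧ (∀ q : ℕ, q.Prime → q ∣ V.conductorNorm ℤ → ¬ (p : ℤ) ∣ (q : ℤ) ^ 2 - 1) ∧ ¬ p ∣ NumberField.classNumber K) ∧ (Module.finrank ℚ K = 2 ∧ NumberField.IsTotallyComplex K ∧ NumberField.discr K < -4 ∧ Int.gcd (NumberField.discr K) (V.conductorNorm ℤ * p) = 1) ∧ (V.conductorNorm ℤ = Nplus * Nminus ∧ Nat.Coprime Nplus Nminus ∧ Odd Nminus.primeFactors.card ∧ (∀ q : ℕ, q.Prime → q ∣ Nplus → ((Ideal.span {(q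 : ℤ)}).primesOver (NumberField.RingOfIntegers K)).ncard = 2) ∧ (∀ q : ℕ, q.Prime → q ∣ Nminus → ((Ideal.span {(q : ℤ)}).primesOver (NumberField.RingOfIntegers K)).ncard = 1)) ∧ (φ ≠ 0 ∧ Literature.NumberTheory.Automorphic.Brandt.eigenLattice (Nplus * Nminus) (Literature.NumberTheory.Automorphic.Brandt.matrix S.O) (fun n => V.LFunction n) = Submodule.span ℤ {φ}))
    (hdeg : ∀ [NeZero (V.conductorNorm ℤ)], ¬ p ∣ ModularForms.minModularDegree V (V.conductorNorm ℤ)) :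
    (((V.quadraticTwist (NumberField.discr K : ℚ)).mordellWeilRank : ℕ) : ℕ∞) ≤
      T.acOrderOfVanishing p φ (padicUnitRoot p (V.LFunction p)) :=
  le_trans (by exact_mod_cast le_max_right _ _) (max_rank_le_acOrderOfVanishing T hC3 h hdeg)

end Datum

/-- **Route DefiniteTheta modulo BD05 Cor. 3, without the crux `DerivedHeightCap`.** Hypotheses: (C3) Bertolini–Darmon 2005
Cor. 3 at every datum (cited named fact); (DEO′) every globally minimal elliptic `V/ℚ` with a multiplicative prime admits an
admissible definite datum (block of `DefiniteExactOrder` verbatim) with, in addition, `p ∤ minModularDegree V N_V`, at which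
`ord_J θ^{ac} ≤ r_an(V)`; and the route's `UBPotentiallyGood`, `SelmerRankLB`, `SelmerRankShaPFinite`, `SelmerRankCM`,
`SerrePrimeSupply` (the last PROVED in the tree). Conclusion: the sub-problem statement `BirchSwinnertonDyer`. Proof = the
certified glue `Theses.DefiniteTheta.closes` with sector (a) re-routed through `mordellWeilRank_le_acOrderOfVanishing`
(`rank ≤ ord_J θ ≤ r_an`) and `corank_p = rank + corank Ш[p^∞] = rank` (Greenberg; `SelmerRankShaPFinite`).
[cite: BertoliniDarmon2005, Cor. 3 (p. 3) and Assumption 6 (3) (p. 4)] [cite: GreenbergLNM1716, §1] -/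
theorem bsd_of_definiteExactOrder'_of_cor3
    (hC3 : ∀ (K : Type) [Field K] [NumberField K] (Nplus Nminus : ℕ) (S : NumberTheory.Automorphic.Brandt.XiSetup Nplus Nminus)
      (p : ℕ) [Fact p.Prime] (W : WeierstrassCurve ℚ), cor3_thetaSq_mem_augIdeal_pow K S p W)
    (hDEO' : ∀ (V : WeierstrassCurve ℚ) [V.IsElliptic] [V.IsGloballyMinimal], (∃ (q : ℕ) (_ : Fact q.Prime), V.HasMultiplicativeReductionAtPrime q) → ∃ (p : ℕ) (_ : Fact p.Prime) (Nplus Nminus : ℕ) (K : Type) (_ : Field K) (_ : NumberField K) (S : Literature.NumberTheory.Automorphic.Brandt.XiSetup Nplus Nminus) (_ : Fintype (Literature.NumberTheory.Automorphic.Brandt.ClassSet S.O)) (T : Literature.NumberTheory.EllipticCurves.GrossPointTower K S p) (φ : Literature.NumberTheory.Automorphic.Brandt.ClassSet S.O → ℤ), ((7 ≤ p ∧ V.HasGoodReductionAtPrime p ∧ ¬ (p : ℤ) ∣ V.frobeniusTrace p ∧ ¬ (p : ℤ) ∣ (V.frobeniusTrace p) ^ 2 - 1 ∧ V.HasSurjectiveModNGaloisRep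 p ∧ (∀ q : ℕ, q.Prime → q ∣ V.conductorNorm ℤ → ¬ (p : ℤ) ∣ (q : ℤ) ^ 2 - 1) ∧ ¬ p ∣ NumberField.classNumber K) ∧ (Module.finrank ℚ K = 2 ∧ NumberField.IsTotallyComplex K ∧ NumberField.discr K < -4 ∧ Int.gcd (NumberField.discr K) (V.conductorNorm ℤ * p) = 1) ∧ (V.conductorNorm ℤ = Nplus * Nminus ∧ Nat.Coprime Nplus Nminus ∧ Odd Nminus.primeFactors.card ∧ (∀ q : ℕ, q.Prime → q ∣ Nplus → ((Ideal.span {(q : ℤ)}).primesOver (NumberField.RingOfIntegers K)).ncard = 2) ∧ (∀ q : ℕ, q.Prime → q ∣ Nminus → ((Ideal.span {(q : ℤ)}).primesOver (NumberField.RingOfIntegers K)).ncard = 1)) ∧ (φ ≠ 0 ∧ Literature.NumberTheory.Automorphic.Brandt.eigenLattice (Nplus * Nminus) (Literature.NumberTheory.Automorphic.Brandt.matrix S.O) (fun n => V.LFunction n) = Submodule.span ℤ {φ})) ∧ (∀ [NeZero (V.conductorNorm ℤ)], ¬ p ∣ ModularForms.minModularDegree V (V.conductorNorm ℤ)) ∧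 T.acOrderOfVanishing p φ (Literature.NumberTheory.EllipticCurves.padicUnitRoot p (V.LFunction p)) ≤ (V.analyticRank : ℕ∞))
    (hPG : UBPotentiallyGood) (hLB : SelmerRankLB) (hSha : SelmerRankShaPFinite) (hCM : SelmerRankCM)
    (hSerre : SerrePrimeSupply) : _root_.BirchSwinnertonDyer := by
  have hId : ∀ (W : WeierstrassCurve ℚ), W.selmerCorank_eq_mordellWeilRank_add :=
    fun W => W.selmerCorank_eq_mordellWeilRank_add_holds
  have hZ : ∀ (W : WeierstrassCurve ℚ) [W.IsElliptic] (p : ℕ) [Fact p.Prime],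
      Finite ↥(AddCommGroup.primaryComponent W.sha p) → W.shaCorank p = 0 :=
    Literature.BSD.shaCorank_eq_zero_of_finite
  -- (T1) the Mordell–Weil rank is an isomorphism invariant (AEC III.3.1(b); `VariableChangePoints`)
  have hMW : ∀ (W : WeierstrassCurve ℚ) (C : WeierstrassCurve.VariableChange ℚ),
      (C • W).mordellWeilRank = W.mordellWeilRank := fun W C =>
    @WeierstrassCurve.VariableChange.finrank_point_variableChange ℚ _ W C (Classical.decEq ℚ)
  -- (T2) the local Euler factor is an isomorphism invariant (AEC VII.1.3(b), VII.2, VII.5.1, C §16)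
  have hloc : ∀ (R : Type) [CommRing R] [IsDomain R] [IsDiscreteValuationRing R]
      (K : Type) [Field K] [Algebra R K] [IsFractionRing R K]
      (W : WeierstrassCurve K) [W.IsElliptic] (C : WeierstrassCurve.VariableChange K),
      (C • W).localEulerFactor R = W.localEulerFactor R := by
    intro R _ _ _ K _ _ _ W _ C
    obtain ⟨D, hD⟩ : ∃ D : WeierstrassCurve.VariableChange K,
        (C • W).minimal R = D • W.minimal R :=
      ⟨((C • W).exists_isMinimal R).choose * C * ((W.exists_isMinimal R).choose)⁻¹, by
        rw [WeierstrassCurve.minimal, WeierstrassCurve.minimal, mul_smul, mul_smul, inv_smul_smul]⟩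
    haveI hE : (W.minimal R).IsElliptic := by rw [WeierstrassCurve.minimal]; infer_instance
    have hΔ : (W.minimal R).Δ ≠ 0 := (W.minimal R).isUnit_Δ.ne_zero
    have hgood : ((C • W).minimal R).HasGoodReduction R ↔ (W.minimal R).HasGoodReduction R := by
      rw [WeierstrassCurve.hasGoodReduction_iff, WeierstrassCurve.hasGoodReduction_iff,
        WeierstrassCurve.valuation_Δ_eq_of_isMinimal_of_eq_smul R hD]
      exact and_congr_left' ⟨fun _ => inferInstance, fun _ => inferInstance⟩
    have hcard : Nat.card (((C • W).minimal R).reduction R).toAffine.Point =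
        Nat.card ((W.minimal R).reduction R).toAffine.Point := by
      obtain ⟨E, hE⟩ := WeierstrassCurve.exists_reduction_eq_smul R hD hΔ
      rw [hE]
      exact WeierstrassCurve.natCard_point_smul _ _
    have hpoly : (C • W).localPolynomial R = W.localPolynomial R := by
      classical
      unfold WeierstrassCurve.localPolynomial
      simp only [hgood, hcard,
        WeierstrassCurve.hasSplitMultiplicativeReduction_iff_of_isMinimal_of_eq_smul R hD hΔ,
        WeierstrassCurve.hasMultiplicativeReduction_iff_of_isMinimal_of_eq_smul R hD hΔ]
    simp only [WeierstrassCurve.localEulerFactor, WeierstrassCurve.localPowerSeries, hpoly]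
  -- (T3) hence the analytic rank is an isomorphism invariant (AEC App. C §16)
  have hAn : ∀ (W : WeierstrassCurve ℚ) [W.IsElliptic] (C : WeierstrassCurve.VariableChange ℚ),
      (C • W).analyticRank = W.analyticRank := by
    intro W _ C
    have hL : (C • W).LFunction = W.LFunction := by
      unfold WeierstrassCurve.LFunction
      congr 1
      funext v
      simp only [WeierstrassCurve.baseChange, ← WeierstrassCurve.map_variableChange]
      exact hloc _ _ _ _
    have hLS : (C • W).LSeries = W.LSeries := by
      funext s
      simp only [WeierstrassCurve.LSeries, hL]
    have hEC : (C • W).entireContinuations = W.entireContinuations := by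
      simp only [WeierstrassCurve.entireContinuations, hLS]
    have hEL : (C • W).entireLFunction = W.entireLFunction := by
      unfold WeierstrassCurve.entireLFunction
      rw [hEC, hLS]
    simp only [WeierstrassCurve.analyticRank, hEL]
  -- Selmer-rank BSD at ONE prime on a global minimal model, in three sectors
  have hmin : ∀ (V : WeierstrassCurve ℚ) [V.IsElliptic] [V.IsGloballyMinimal],
      ∃ (p : ℕ) (_ : Fact p.Prime), V.selmerCorank p = V.analyticRank := by
    intro V _ _
    by_cases hm : ∃ (q : ℕ) (_ : Fact q.Prime), V.HasMultiplicativeReductionAtPrime q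
    · -- (a) a multiplicative prime: the definite exact-order datum WITH `p ∤ deg`, and BD05 Cor. 3 in place of the cap
      obtain ⟨p, hp, Nplus, Nminus, K, hFK, hNK, S, hFin, T, φ, hC, hdeg, hθ⟩ := hDEO' V hm
      obtain ⟨⟨h7, hgood, hord, hPO, hsurj, hq2, hhK⟩, hrest⟩ := hC
      have hcap : ((V.mordellWeilRank : ℕ) : ℕ∞) ≤ T.acOrderOfVanishing p φ
          (Literature.NumberTheory.EllipticCurves.padicUnitRoot p (V.LFunction p)) :=
        mordellWeilRank_le_acOrderOfVanishing T (hC3 K Nplus Nminus S p V)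
          ⟨⟨h7, hgood, hord, hPO, hsurj, hq2, hhK⟩, hrest⟩ hdeg
      have hUB : V.mordellWeilRank ≤ V.analyticRank := by
        have h := hcap.trans hθ
        exact_mod_cast h
      have h5 : 5 ≤ p := le_trans (by norm_num) h7
      have hsel : V.selmerCorank p = V.mordellWeilRank := by
        rw [hId V p, hZ V p (hSha V p), add_zero]
      refine ⟨p, hp, le_antisymm ?_ (hLB V p h5 hgood hord hsurj)⟩
      rw [hsel]
      exact hUB
    · by_cases hW : V.HasCM
      · -- (c) CM (integral j automatically): any good ordinary p ≥ 5, then SelmerRankCM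
        obtain ⟨p, hp, h5, hgood, hord⟩ := WeierstrassCurve.exists_good_ordinary_prime_holds V
        exact ⟨p, hp, hCM V p h5 hgood hord hW⟩
      · -- (b) potentially good everywhere, no CM: the Serre big-image good ordinary prime
        obtain ⟨p, hp, h5, hgood, hord, hsurj⟩ := hSerre V hW
        exact ⟨p, hp, le_antisymm (hPG V hm p h5 hgood hord hsurj) (hLB V p h5 hgood hord hsurj)⟩
  -- transport to an arbitrary model and assemble
  refine Literature.BSD.selmerCorank_identity_imp_thesis_imp_bsd hId ?_
  intro W _
  obtain ⟨C, hC⟩ := WeierstrassCurve.hasGlobalMinimalModel_rat_holds W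
  obtain ⟨p, hp, hminp⟩ := hmin (C • W)
  refine ⟨p, hp.out, ?_, hZ W p (hSha W p)⟩
  have h1 : W.selmerCorank p = W.mordellWeilRank + W.shaCorank p := hId W p
  have h2 : (C • W).selmerCorank p = (C • W).mordellWeilRank + (C • W).shaCorank p := hId (C • W) p
  have h3 : W.shaCorank p = 0 := hZ W p (hSha W p)
  have h4 : (C • W).shaCorank p = 0 := hZ (C • W) p (hSha (C • W) p)
  have h6 := hMW W C
  have h7 := hAn W C
  omega

/-- **The same with Serre's prime supply discharged** (`SerrePrimeSupply` is PROVED in the tree: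
`Theorems.exists_goodOrdinary_surjective_of_not_hasCM`, Serre's open image theorem + infinitely many good ordinary primes, as
in `Theorems.frozenTwin_serrePrimeSupply_proof`): modulo BD05 Cor. 3 the route's open hypotheses are exactly
`DefiniteExactOrder′`, `UBPotentiallyGood`, `SelmerRankLB`, `SelmerRankShaPFinite`, `SelmerRankCM`.
[cite: BertoliniDarmon2005, Cor. 3 (p. 3)] [cite: Serre1972, §4.2 Théorème 2] -/
theorem bsd_of_definiteExactOrder'_of_cor3'
    (hC3 : ∀ (K : Type) [Field K] [NumberField K] (Nplus Nminus : ℕ) (S : NumberTheory.Automorphic.Brandt.XiSetup Nplus Nminus)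
      (p : ℕ) [Fact p.Prime] (W : WeierstrassCurve ℚ), cor3_thetaSq_mem_augIdeal_pow K S p W)
    (hDEO' : ∀ (V : WeierstrassCurve ℚ) [V.IsElliptic] [V.IsGloballyMinimal], (∃ (q : ℕ) (_ : Fact q.Prime), V.HasMultiplicativeReductionAtPrime q) → ∃ (p : ℕ) (_ : Fact p.Prime) (Nplus Nminus : ℕ) (K : Type) (_ : Field K) (_ : NumberField K) (S : Literature.NumberTheory.Automorphic.Brandt.XiSetup Nplus Nminus) (_ : Fintype (Literature.NumberTheory.Automorphic.Brandt.ClassSet S.O)) (T : Literature.NumberTheory.EllipticCurves.GrossPointTower K S p) (φ : Literature.NumberTheory.Automorphic.Brandt.ClassSet S.O → ℤ), ((7 ≤ p ∧ V.HasGoodReductionAtPrime p ∧ ¬ (p : ℤ) ∣ V.frobeniusTrace p ∧ ¬ (p : ℤ) ∣ (V.frobeniusTrace p) ^ 2 - 1 ∧ V.HasSurjectiveModNGaloisRep p ∧ (∀ q : ℕ, q.Prime → q ∣ V.conductorNorm ℤ → ¬ (p : ℤ) ∣ (q : ℤ) ^ 2 - 1) ∧ ¬ p ∣ NumberField.classNumber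 K) ∧ (Module.finrank ℚ K = 2 ∧ NumberField.IsTotallyComplex K ∧ NumberField.discr K < -4 ∧ Int.gcd (NumberField.discr K) (V.conductorNorm ℤ * p) = 1) ∧ (V.conductorNorm ℤ = Nplus * Nminus ∧ Nat.Coprime Nplus Nminus ∧ Odd Nminus.primeFactors.card ∧ (∀ q : ℕ, q.Prime → q ∣ Nplus → ((Ideal.span {(q : ℤ)}).primesOver (NumberField.RingOfIntegers K)).ncard = 2) ∧ (∀ q : ℕ, q.Prime → q ∣ Nminus → ((Ideal.span {(q : ℤ)}).primesOver (NumberField.RingOfIntegers K)).ncard = 1)) ∧ (φ ≠ 0 ∧ Literature.NumberTheory.Automorphic.Brandt.eigenLattice (Nplus * Nminus) (Literature.NumberTheory.Automorphic.Brandt.matrix S.O) (fun n => V.LFunction n) = Submodule.span ℤ {φ})) ∧ (∀ [NeZero (V.conductorNorm ℤ)], ¬ p ∣ ModularForms.minModularDegree V (V.conductorNorm ℤ)) ∧ T.acOrderOfVanishing p φ (Literature.NumberTheory.EllipticCurves.padicUnitRoot p (V.LFunction p)) ≤ (V.analyticRank : ℕ∞))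
    (hPG : UBPotentiallyGood) (hLB : SelmerRankLB) (hSha : SelmerRankShaPFinite) (hCM : SelmerRankCM) :
    _root_.BirchSwinnertonDyer :=
  bsd_of_definiteExactOrder'_of_cor3 hC3 hDEO' hPG hLB hSha hCM
    fun W _ _ hW => exists_goodOrdinary_surjective_of_not_hasCM W hW

end Summit.BirchSwinnertonDyer.BirchSwinnertonDyer.Theorems.DerivedHeightCapBD05

end
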